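import Summits.CriticalPhenomena.PercolationContinuityZ3.Theorems.PercNearOneGluingNoHeavyLowerTailOneCutCertKronecker

/-!
# `AdditiveGluing` (crux stmt-CriticalPhenomena-4576), kernel (T) = `stub_k0CovTransferQ_c9`: the algebra of
# THREE-copy (degree-3 tensor-Bernstein) certificates and their Kronecker digit test

Support file (certificate seat `prim-cert-2`; `--supports stmt-CriticalPhenomena-4576`).  Measure-free layer, the three-copy
analogue of `…NoHeavyLowerTailOneCutCertAlgebra` / `…OneCutCertKronecker` (whose `mono`, `ML`, `InCube`, `digit`, `digitsGe` it
reuses).  The covariance transfer (T) is a signed sum of products of THREE percolation probabilities, i.e. of three multilinear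
polynomials `ML X · ML Y · ML Z` in the edge weights; such a product regroups over KEYS `k : Fin m → Fin 4` (`k_i` = number of
copies in which coordinate `i` is "open") with the degree-3 weights `bern4 t d = t^d (1 − t)^{3−d} ≥ 0` and the FIBRE SUMS
`pcoef3 X Y Z k = Σ_{key3 g h l = k} X g · Y h · Z l` (`ML_mul_ML_mul_ML`).  Hence a signed cubic combination is nonnegative on
the unit cube as soon as all its fibre sums are (`cubicForm_nonneg` — the "fibre criterion"; cf. lead c12's
`…AdditiveGluingFibreCriterion`, which states the same criterion over replica triples).  For INTEGER tables the fibre sums are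
the base-`M` digits of `KR4 X · KR4 Y · KR4 Z`, `KR4 T = Σ_g T g · M^{e4 g}`, `e4 g = Σ_i g_i 4^i` (no carries:
`e4 g + e4 h + e4 l = E4 (key3 g h l)`), and `cubicCoef_nonneg_of_digit_ge` turns a lower bound on the digits (checked by the AND-mask test of `…OneCutCertCheck`)
into the nonnegativity of every fibre sum.

Nothing here mentions percolation; no proposition about the crux is asserted.
-/

namespace Summit.CriticalPhenomena.PercolationContinuityZ3.Theorems.CovTransferCert

open Finset OneCutCert
open scoped BigOperators

variable {m : ℕ}

/-! ## Keys of three copies and the degree-3 Bernstein weights -/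

/-- The digit of three bits: `a + b + c ∈ {0,1,2,3}`. [this work] -/
def bkey3 (a b c : Bool) : Fin 4 :=
  ⟨a.toNat + b.toNat + c.toNat, by cases a <;> cases b <;> cases c <;> decide⟩

/-- The key of three corners: `k_i = g_i + h_i + l_i`. [this work] -/
def key3 (g h l : Fin m → Bool) : Fin m → Fin 4 := fun i => bkey3 (g i) (h i) (l i)

/-- The scaled degree-3 Bernstein weight of a digit: `t^d (1 − t)^{3−d}`. [this work] -/
def bern4 (t : ℝ) (d : Fin 4) : ℝ := t ^ (d : ℕ) * (1 - t) ^ (3 - (d : ℕ))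

/-- The degree-3 weights are nonnegative on `[0,1]`. [folklore] -/
theorem bern4_nonneg {t : ℝ} (ht : 0 ≤ t ∧ t ≤ 1) (d : Fin 4) : 0 ≤ bern4 t d :=
  mul_nonneg (pow_nonneg ht.1 _) (pow_nonneg (sub_nonneg.2 ht.2) _)

/-- One coordinate: the product of three Bernoulli factors is the Bernstein weight of their digit. [this work] -/
theorem pick3 (t : ℝ) (a b c : Bool) :
    (if a then t else 1 - t) * (if b then t else 1 - t) * (if c then t else 1 - t) = bern4 t (bkey3 a b c) := by
  cases a <;> cases b <;> cases c <;>
    simp only [bern4, bkey3, Bool.toNat_true, Bool.toNat_false, Nat.reduceAdd, Nat.reduceSub, Bool.false_eq_true,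
      if_true, if_false, pow_zero, pow_one] <;> ring

/-- The product of three corner weights depends only on the key. [this work] -/
theorem mono3 (x : Fin m → ℝ) (g h l : Fin m → Bool) :
    mono x g * mono x h * mono x l = ∏ i, bern4 (x i) (key3 g h l i) := by
  unfold mono
  rw [← Finset.prod_mul_distrib, ← Finset.prod_mul_distrib]
  exact Finset.prod_congr rfl fun i _ => pick3 (x i) (g i) (h i) (l i)

/-- The three-copy fibre sum of the key `k`: `Σ_{key3 g h l = k} A g · B h · C l`. [this work] -/
def pcoef3 {R : Type*} [CommRing R] (A B C : (Fin m → Bool) → R) (k : Fin m → Fin 4) : R :=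
  ∑ g, ∑ h, ∑ l, if key3 g h l = k then A g * B h * C l else 0

/-- **Regrouping by keys (three copies).** [this work] -/
theorem sum3_key {R : Type*} [CommRing R] (A B C : (Fin m → Bool) → R) (φ ψ χ : (Fin m → Bool) → R)
    (W : (Fin m → Fin 4) → R) (hW : ∀ g h l, φ g * ψ h * χ l = W (key3 g h l)) :
    (∑ g, A g * φ g) * (∑ h, B h * ψ h) * (∑ l, C l * χ l) = ∑ k, pcoef3 A B C k * W k := by
  classical
  have h1 : ∀ g h l : Fin m → Bool, A g * φ g * (B h * ψ h) * (C l * χ l) =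
      ∑ k : Fin m → Fin 4, (if key3 g h l = k then A g * B h * C l else 0) * W k := by
    intro g h l
    rw [Finset.sum_eq_single (key3 g h l)]
    · rw [if_pos rfl, ← hW g h l]; ring
    · intro k _ hk; rw [if_neg (Ne.symm hk), zero_mul]
    · intro hk; exact absurd (Finset.mem_univ _) hk
  calc (∑ g, A g * φ g) * (∑ h, B h * ψ h) * (∑ l, C l * χ l)
      = ∑ g, ∑ h, ∑ l, A g * φ g * (B h * ψ h) * (C l * χ l) := by
        rw [Finset.sum_mul_sum, Finset.sum_mul]
        refine Finset.sum_congr rfl fun g _ => ?_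
        rw [Finset.sum_mul]
        exact Finset.sum_congr rfl fun h _ => by rw [Finset.mul_sum]
    _ = ∑ g, ∑ h, ∑ l, ∑ k, (if key3 g h l = k then A g * B h * C l else 0) * W k :=
        Finset.sum_congr rfl fun g _ => Finset.sum_congr rfl fun h _ => Finset.sum_congr rfl fun l _ => h1 g h l
    _ = ∑ g, ∑ h, ∑ k, ∑ l, (if key3 g h l = k then A g * B h * C l else 0) * W k :=
        Finset.sum_congr rfl fun g _ => Finset.sum_congr rfl fun h _ => Finset.sum_comm
    _ = ∑ g, ∑ k, ∑ h, ∑ l, (if key3 g h l = k then A g * B h * C l else 0) * W k :=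
        Finset.sum_congr rfl fun g _ => Finset.sum_comm
    _ = ∑ k, ∑ g, ∑ h, ∑ l, (if key3 g h l = k then A g * B h * C l else 0) * W k := Finset.sum_comm
    _ = ∑ k, pcoef3 A B C k * W k := by
        unfold pcoef3
        refine Finset.sum_congr rfl fun k _ => ?_
        simp_rw [Finset.sum_mul]

/-- **Product of three multilinear polynomials in the degree-3 Bernstein basis.** [this work] -/
theorem ML_mul_ML_mul_ML (A B C : (Fin m → Bool) → ℝ) (x : Fin m → ℝ) :
    ML A x * ML B x * ML C x = ∑ k, pcoef3 A B C k * ∏ i, bern4 (x i) (k i) := by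
  unfold ML
  exact sum3_key A B C (mono x) (mono x) (mono x) (fun k => ∏ i, bern4 (x i) (k i)) (mono3 x)

/-! ## Signed cubic combinations with integer tables -/

/-- A signed combination of `J` products of three multilinear polynomials with integer corner tables. [this work] -/
def cubicForm {J : Type*} [Fintype J] (s : J → ℤ) (X Y Z : J → (Fin m → Bool) → ℤ) (x : Fin m → ℝ) : ℝ :=
  ∑ j, (s j : ℝ) * (ML (fun g => (X j g : ℝ)) x * ML (fun g => (Y j g : ℝ)) x * ML (fun g => (Z j g : ℝ)) x)

/-- Its integer fibre sums. [this work] -/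
def cubicCoef {J : Type*} [Fintype J] (s : J → ℤ) (X Y Z : J → (Fin m → Bool) → ℤ) (k : Fin m → Fin 4) : ℤ :=
  ∑ j, s j * pcoef3 (X j) (Y j) (Z j) k

/-- Casting integer fibre sums. [this work] -/
theorem pcoef3_cast (A B C : (Fin m → Bool) → ℤ) (k : Fin m → Fin 4) :
    pcoef3 (fun g => (A g : ℝ)) (fun g => (B g : ℝ)) (fun g => (C g : ℝ)) k = ((pcoef3 A B C k : ℤ) : ℝ) := by
  unfold pcoef3
  push_cast
  rfl

/-- The cubic form in the degree-3 Bernstein basis. [this work] -/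
theorem cubicForm_eq {J : Type*} [Fintype J] (s : J → ℤ) (X Y Z : J → (Fin m → Bool) → ℤ) (x : Fin m → ℝ) :
    cubicForm s X Y Z x = ∑ k, (cubicCoef s X Y Z k : ℝ) * ∏ i, bern4 (x i) (k i) := by
  unfold cubicForm cubicCoef
  simp_rw [ML_mul_ML_mul_ML, pcoef3_cast, Finset.mul_sum]
  rw [Finset.sum_comm]
  refine Finset.sum_congr rfl fun k _ => ?_
  push_cast
  rw [Finset.sum_mul]
  exact Finset.sum_congr rfl fun j _ => by ring

/-- **The fibre criterion**: fibrewise nonnegativity implies nonnegativity on the cube. [this work] -/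
theorem cubicForm_nonneg {J : Type*} [Fintype J] {s : J → ℤ} {X Y Z : J → (Fin m → Bool) → ℤ}
    (hk : ∀ k, 0 ≤ cubicCoef s X Y Z k) {x : Fin m → ℝ} (hx : InCube x) : 0 ≤ cubicForm s X Y Z x := by
  rw [cubicForm_eq]
  exact Finset.sum_nonneg fun k _ =>
    mul_nonneg (by exact_mod_cast hk k) (Finset.prod_nonneg fun i _ => bern4_nonneg (hx i) (k i))

/-! ## Base-4 positions and Kronecker numbers -/

/-- Position of a corner: `Σ_i g_i 4^i`. [this work] -/
def e4 (g : Fin m → Bool) : ℕ := ∑ i, (g i).toNat * 4 ^ (i : ℕ)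

/-- Position of a key: `Σ_i k_i 4^i`. [this work] -/
def E4 (k : Fin m → Fin 4) : ℕ := ∑ i, (k i : ℕ) * 4 ^ (i : ℕ)

/-- Positions add digitwise, without carries: `e4 g + e4 h + e4 l = E4 (key3 g h l)`. [this work] -/
theorem e4_add3 (g h l : Fin m → Bool) : e4 g + e4 h + e4 l = E4 (key3 g h l) := by
  unfold e4 E4
  rw [← Finset.sum_add_distrib, ← Finset.sum_add_distrib]
  refine Finset.sum_congr rfl fun i _ => ?_
  rw [show ((key3 g h l i : Fin 4) : ℕ) = (g i).toNat + (h i).toNat + (l i).toNat from rfl]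
  ring

/-- `E4` is Mathlib's `finFunctionFinEquiv`. [this work] -/
theorem E4_eq (k : Fin m → Fin 4) : E4 k = (finFunctionFinEquiv k : ℕ) := by
  rw [finFunctionFinEquiv_apply]; rfl

/-- The Kronecker number of an integer corner table in base `M`, base-4 positions: `Σ_g T g · M^{e4 g}`. [this work] -/
def KR4 (M : ℕ) (T : (Fin m → Bool) → ℤ) : ℤ := ∑ g, T g * (M : ℤ) ^ e4 g

/-- **Product of three Kronecker numbers = fibre sums in base `M`.** [this work] -/
theorem KR4_mul3 (M : ℕ) (A B C : (Fin m → Bool) → ℤ) :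
    KR4 M A * KR4 M B * KR4 M C = ∑ k, pcoef3 A B C k * (M : ℤ) ^ E4 k := by
  unfold KR4
  exact sum3_key A B C _ _ _ (fun k => (M : ℤ) ^ E4 k) (fun g h l => by rw [← pow_add, ← pow_add, e4_add3])

/-- The certificate number `Z = Σ_j s_j · KR4 X_j · KR4 Y_j · KR4 Z_j`. [this work] -/
def cubicZ {J : Type*} [Fintype J] (M : ℕ) (s : J → ℤ) (X Y Z : J → (Fin m → Bool) → ℤ) : ℤ :=
  ∑ j, s j * (KR4 M (X j) * KR4 M (Y j) * KR4 M (Z j))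

/-- `Z = Σ_k c_k M^{E4 k}`. [this work] -/
theorem cubicZ_eq {J : Type*} [Fintype J] (M : ℕ) (s : J → ℤ) (X Y Z : J → (Fin m → Bool) → ℤ) :
    cubicZ M s X Y Z = ∑ k, cubicCoef s X Y Z k * (M : ℤ) ^ E4 k := by
  unfold cubicZ cubicCoef
  simp_rw [KR4_mul3, Finset.mul_sum]
  rw [Finset.sum_comm]
  refine Finset.sum_congr rfl fun k _ => ?_
  rw [Finset.sum_mul]
  exact Finset.sum_congr rfl fun j _ => by ring

/-- A bound on all integer fibre sums. [this work] -/
def CoefBound3 {J : Type*} [Fintype J] (s : J → ℤ) (X Y Z : J → (Fin m → Bool) → ℤ) (K : ℕ) : Prop :=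
  ∀ k, |cubicCoef s X Y Z k| < K

/-- **Digit criterion (three copies).** If every fibre sum is `< K = 2^(s-1)` in absolute value,
`Z + K·Σ_{j<4^m} (2^s)^j` equals the natural number `N`, and all `4^m` lowest base-`2^s` digits of `N` are `≥ K`, then every
fibre sum is nonnegative. [this work] -/
theorem cubicCoef_nonneg_of_digit_ge {J : Type*} [Fintype J] {s : J → ℤ} {X Y Z : J → (Fin m → Bool) → ℤ} {σ : ℕ}
    (hσ : 0 < σ) (hB : CoefBound3 s X Y Z (2 ^ (σ - 1))) (N : ℕ)
    (hN : (N : ℤ) = cubicZ (2 ^ σ) s X Y Z + ∑ j : Fin (4 ^ m), (2 : ℤ) ^ (σ - 1) * (2 ^ σ) ^ (j : ℕ))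
    (hdig : ∀ j : ℕ, j < 4 ^ m → 2 ^ (σ - 1) ≤ digit (2 ^ σ) N j) :
    ∀ k, 0 ≤ cubicCoef s X Y Z k := by
  have hK2 : (2 : ℕ) ^ σ = 2 * 2 ^ (σ - 1) := by
    rw [← pow_succ']; congr 1; omega
  let d : Fin (4 ^ m) → ℕ := fun j => (cubicCoef s X Y Z (finFunctionFinEquiv.symm j) + 2 ^ (σ - 1)).toNat
  have hdnn : ∀ k, 0 ≤ cubicCoef s X Y Z k + 2 ^ (σ - 1) := fun k => by
    have := (abs_lt.1 (hB k)).1; push_cast at this ⊢; linarith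
  have hK2z : (2 : ℤ) ^ σ = 2 * 2 ^ (σ - 1) := by exact_mod_cast hK2
  have hdlt : ∀ j, d j < 2 ^ σ := fun j => by
    have h1 := (abs_lt.1 (hB (finFunctionFinEquiv.symm j))).2
    have h2 := hdnn (finFunctionFinEquiv.symm j)
    have h3 : ((d j : ℕ) : ℤ) < (2 : ℤ) ^ σ := by
      simp only [d]
      rw [Int.toNat_of_nonneg h2, hK2z]
      push_cast at h1 ⊢
      linarith
    exact_mod_cast h3
  have hNsum : N = ∑ j : Fin (4 ^ m), d j * (2 ^ σ) ^ (j : ℕ) := by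
    zify
    rw [hN, cubicZ_eq, ← (Equiv.sum_comp finFunctionFinEquiv.symm
      (fun k => cubicCoef s X Y Z k * ((2 ^ σ : ℕ) : ℤ) ^ E4 k)), ← Finset.sum_add_distrib]
    refine Finset.sum_congr rfl fun j _ => ?_
    have hEj : E4 (finFunctionFinEquiv.symm j) = (j : ℕ) := by
      rw [E4_eq, Equiv.apply_symm_apply]
    rw [hEj]
    simp only [d]
    rw [Int.toNat_of_nonneg (hdnn _)]
    push_cast
    ring
  intro k
  have hj := hdig (finFunctionFinEquiv k) (finFunctionFinEquiv k).2
  rw [hNsum] at hj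
  have hdd := digit_of_sum _ (pow_pos (by norm_num) σ) _ d hdlt (finFunctionFinEquiv k)
  rw [hdd] at hj
  have h2 := hdnn k
  simp only [d, Equiv.symm_apply_apply] at hj
  zify at hj
  rw [Int.toNat_of_nonneg h2] at hj
  linarith

end Summit.CriticalPhenomena.PercolationContinuityZ3.Theorems.CovTransferCert
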